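import Literature.MathematicalPhysics.QuantumLattice.GrassmannIntegral
import Mathlib.MeasureTheory.Integral.IntervalIntegral.Periodic
import Mathlib.Analysis.SpecialFunctions.Complex.Circle
import HarnessLib

/-!
# The normalised Haar measure of `U(1)` and of `U(1)^ι` in the angle parametrisation

Support file for the duality transformation of four-dimensional `U(1)` lattice gauge theory with
the Villain action (proof programme of the named fact
`Literature.MathematicalPhysics.QuantumFieldTheory.FrohlichSpencerU1PerimeterLawD4` and of its
corollary `Literature.Barriers.QuantumFields.AbelianDeconfinementD4`). Fröhlich–Spencer write the
functional measure of compact lattice QED in link ANGLES, `∏_{xy} dθ_{xy}`, `θ ∈ [-π, π)` (FS82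
(2.1)–(2.3)), while the tree's `U(1)` theories (`zdVillainMeasure`, `zdHaar`, `LatticeAxialGauge`)
integrate against the normalised Haar measure `haarProbability Circle` of the compact group
`U(1) = Circle`. This file identifies the two:

* `map_toCircle_volume`: the push-forward of the Haar measure of `ℝ/2πℤ` (total mass `2π`) under
  the isomorphism `AddCircle.toCircle` is `2π · haarProbability Circle` (left invariance plus
  uniqueness of Haar measure);
* `map_exp_angleMeasure : (angle measure (2π)⁻¹ dθ on (-π, π]).map Circle.exp = haarProbability`,
  `integral_haarProbability_circle : ∫ g dHaar = (2π)⁻¹ ∫_{(-π,π]} g(e^{iθ}) dθ`;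
* the product version for a finite index type `ι` (`measurePreserving_exp_pi`,
  `integral_pi_haarProbability_circle`):
  `∫_{U(1)^ι} G dHaar^ι = (2π)^{-|ι|} ∫_{(-π,π]^ι} G(e^{iθ}) dθ`.

Everything is proved; no named fact is introduced.

## References

* J. Fröhlich, T. Spencer, Comm. Math. Phys. 83 (1982) 411–454, §2.2 (2.1)–(2.3).
  [FrohlichSpencerCMP1982]
-/

noncomputable section

open MeasureTheory Measure Set
open Literature.MathematicalPhysics.QuantumFieldTheory (haarProbability)

namespace Literature.MathematicalPhysics.QuantumFieldTheory

namespace CircleHaar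

/-! ### `U(1)`: Haar measure and angles -/

/-- `0 < 2π`, as a `Fact` instance for `AddCircle (2π)`. [folklore] -/
instance : Fact (0 < 2 * Real.pi) := ⟨by positivity⟩

/-- `toCircle : ℝ/2πℤ → U(1)` is `θ ↦ e^{iθ}` on representatives. [folklore] -/
theorem toCircle_coe (θ : ℝ) : AddCircle.toCircle ((θ : ℝ) : AddCircle (2 * Real.pi)) = Circle.exp θ := by
  rw [AddCircle.toCircle_apply_mk, div_self (by positivity), one_mul]

/-- `toCircle : ℝ/2πℤ → U(1)` is onto. [folklore] -/
theorem toCircle_surjective : Function.Surjective (AddCircle.toCircle (T := 2 * Real.pi)) := by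
  intro w
  obtain ⟨θ, rfl⟩ := Circle.exp_surjective w
  exact ⟨θ, toCircle_coe θ⟩

/-- **The push-forward of the Haar measure of `ℝ/2πℤ` to `U(1)` is `2π` times the normalised
Haar measure** (it is a left-invariant finite measure of total mass `2π`; uniqueness of Haar
measure). [folklore] -/
theorem map_toCircle_volume :
    (volume : Measure (AddCircle (2 * Real.pi))).map AddCircle.toCircle =
      ENNReal.ofReal (2 * Real.pi) • haarProbability Circle := by
  set ν := (volume : Measure (AddCircle (2 * Real.pi))).map AddCircle.toCircle with hν
  have hmeas : Measurable (AddCircle.toCircle (T := 2 * Real.pi)) :=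
    AddCircle.continuous_toCircle.measurable
  haveI : ν.IsMulLeftInvariant := by
    refine ⟨fun w => ?_⟩
    obtain ⟨a, rfl⟩ := toCircle_surjective w
    rw [hν, Measure.map_map (measurable_const_mul _) hmeas]
    have hcomp : (fun z => AddCircle.toCircle a * z) ∘ AddCircle.toCircle (T := 2 * Real.pi) =
        AddCircle.toCircle ∘ fun x => a + x := by
      funext x
      simp [AddCircle.toCircle_add]
    rw [hcomp, ← Measure.map_map hmeas (measurable_const_add a), map_add_left_eq_self]
  have huniq := haarMeasure_unique ν (⊤ : TopologicalSpace.PositiveCompacts Circle)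
  have htop : ν (⊤ : TopologicalSpace.PositiveCompacts Circle) = ENNReal.ofReal (2 * Real.pi) := by
    rw [TopologicalSpace.PositiveCompacts.coe_top, hν, Measure.map_apply hmeas MeasurableSet.univ,
      Set.preimage_univ, AddCircle.measure_univ]
  rw [huniq, htop]
  rfl

/-- **The normalised angle measure** `(2π)⁻¹ dθ` on `(-π, π]`. [cite: FrohlichSpencerCMP1982, §2.2 (2.1)] -/
def angleMeasure : Measure ℝ :=
  (ENNReal.ofReal (2 * Real.pi))⁻¹ • volume.restrict (Ioc (-Real.pi) Real.pi)

/-- `2π ≠ 0, ∞` in `ℝ≥0∞`. [folklore] -/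
theorem ofReal_two_pi_ne_zero : ENNReal.ofReal (2 * Real.pi) ≠ 0 := by
  rw [ne_eq, ENNReal.ofReal_eq_zero, not_le]; positivity

/-- The normalised angle measure is a probability measure. [folklore] -/
instance : IsProbabilityMeasure angleMeasure := ⟨by
  rw [angleMeasure, Measure.smul_apply, Measure.restrict_apply MeasurableSet.univ, Set.univ_inter,
    Real.volume_Ioc, smul_eq_mul, show Real.pi - -Real.pi = 2 * Real.pi by ring,
    ENNReal.inv_mul_cancel ofReal_two_pi_ne_zero ENNReal.ofReal_ne_top]⟩

/-- **`θ ↦ e^{iθ}` pushes the normalised angle measure to the normalised Haar measure of `U(1)`.**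
[folklore] -/
theorem map_exp_angleMeasure : angleMeasure.map Circle.exp = haarProbability Circle := by
  rw [angleMeasure, Measure.map_smul]
  -- `exp = toCircle ∘ mk` and `mk` pushes Lebesgue on `(-π, -π + 2π]` to the volume of `ℝ/2πℤ`
  have hfac : (Circle.exp : ℝ → Circle) =
      AddCircle.toCircle ∘ ((↑) : ℝ → AddCircle (2 * Real.pi)) := by
    funext θ; exact (toCircle_coe θ).symm
  have hIoc : Ioc (-Real.pi) Real.pi = Ioc (-Real.pi) (-Real.pi + 2 * Real.pi) := by
    congr 1; ring
  have hmk : Measurable (fun θ : ℝ => (θ : AddCircle (2 * Real.pi))) :=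
    (AddCircle.continuous_mk' (2 * Real.pi)).measurable
  rw [hfac, ← Measure.map_map AddCircle.continuous_toCircle.measurable hmk,
    hIoc, (AddCircle.measurePreserving_mk (2 * Real.pi) (-Real.pi)).map_eq, map_toCircle_volume,
    smul_smul, ENNReal.inv_mul_cancel ofReal_two_pi_ne_zero ENNReal.ofReal_ne_top, one_smul]

/-- `θ ↦ e^{iθ}` is measure preserving from the normalised angle measure to `haarProbability`.
[folklore] -/
theorem measurePreserving_exp : MeasurePreserving Circle.exp angleMeasure (haarProbability Circle) :=
  ⟨Circle.exp.continuous.measurable, map_exp_angleMeasure⟩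

/-- **Haar integrals over `U(1)` in angles**: `∫ g dHaar = (2π)⁻¹ ∫_{(-π,π]} g(e^{iθ}) dθ` for
`g` a.e.-strongly measurable. [cite: FrohlichSpencerCMP1982, §2.2 (2.1)–(2.3)] -/
theorem integral_haarProbability_circle {E : Type*} [NormedAddCommGroup E] [NormedSpace ℝ E]
    (g : Circle → E) (hg : AEStronglyMeasurable g (haarProbability Circle)) :
    ∫ z, g z ∂(haarProbability Circle) =
      (2 * Real.pi)⁻¹ • ∫ θ in Ioc (-Real.pi) Real.pi, g (Circle.exp θ) := by
  rw [← map_exp_angleMeasure] at hg ⊢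
  rw [integral_map Circle.exp.continuous.measurable.aemeasurable hg, angleMeasure,
    integral_smul_measure, ENNReal.toReal_inv, ENNReal.toReal_ofReal (by positivity)]

/-! ### `U(1)^ι`: the product Haar measure and angles -/

variable {ι : Type*} [Fintype ι]

/-- Scaling every factor scales the product measure by the power of the constant. [folklore] -/
theorem pi_const_smul {α : Type*} [MeasurableSpace α] (μ : Measure α) [SigmaFinite μ] (c : ENNReal)
    [SigmaFinite (c • μ)] :
    Measure.pi (fun _ : ι => c • μ) = c ^ Fintype.card ι • Measure.pi fun _ : ι => μ := by
  refine Measure.pi_eq fun s _ => ?_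
  rw [Measure.smul_apply, Measure.pi_pi, smul_eq_mul]
  simp only [Measure.smul_apply, smul_eq_mul]
  rw [Finset.prod_mul_distrib, Finset.prod_const, Finset.card_univ]

/-- `θ ↦ (e^{iθ_i})_i` is measure preserving from the product of normalised angle measures to the
product Haar measure of `U(1)^ι`. [folklore] -/
theorem measurePreserving_exp_pi :
    MeasurePreserving (fun θ : ι → ℝ => fun i => Circle.exp (θ i))
      (Measure.pi fun _ : ι => angleMeasure) (Measure.pi fun _ : ι => haarProbability Circle) :=
  measurePreserving_pi _ _ fun _ => measurePreserving_exp

/-- The product of the normalised angle measures is `(2π)^{-|ι|}` times Lebesgue measure on the cube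
`(-π, π]^ι`. [folklore] -/
theorem pi_angleMeasure :
    Measure.pi (fun _ : ι => angleMeasure) =
      (ENNReal.ofReal (2 * Real.pi))⁻¹ ^ Fintype.card ι •
        (volume : Measure (ι → ℝ)).restrict (Set.pi univ fun _ => Ioc (-Real.pi) Real.pi) := by
  haveI : SigmaFinite ((ENNReal.ofReal (2 * Real.pi))⁻¹ • volume.restrict (Ioc (-Real.pi) Real.pi)) :=
    show SigmaFinite angleMeasure by infer_instance
  rw [angleMeasure, pi_const_smul, ← Measure.restrict_pi_pi, volume_pi]

/-- **Haar integrals over `U(1)^ι` in angles**: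
`∫_{U(1)^ι} G dHaar^ι = (2π)^{-|ι|} ∫_{(-π,π]^ι} G((e^{iθ_i})_i) dθ` for `G` a.e.-strongly
measurable (the link-angle form `∏ dθ_{xy}/2π` of the functional measure).
[cite: FrohlichSpencerCMP1982, §2.2 (2.1)–(2.3)] -/
theorem integral_pi_haarProbability_circle {E : Type*} [NormedAddCommGroup E] [NormedSpace ℝ E]
    (G : (ι → Circle) → E) (hG : AEStronglyMeasurable G (Measure.pi fun _ : ι => haarProbability Circle)) :
    ∫ u, G u ∂(Measure.pi fun _ : ι => haarProbability Circle) =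
      ((2 * Real.pi)⁻¹) ^ Fintype.card ι •
        ∫ θ in Set.pi univ (fun _ => Ioc (-Real.pi) Real.pi), G (fun i => Circle.exp (θ i)) := by
  rw [← measurePreserving_exp_pi.map_eq] at hG ⊢
  rw [integral_map measurePreserving_exp_pi.measurable.aemeasurable hG, pi_angleMeasure,
    integral_smul_measure, ENNReal.toReal_pow, ENNReal.toReal_inv, ENNReal.toReal_ofReal (by positivity)]

/-- The cube `(-π, π]^ι` may be replaced by `[-π, π)^ι` in Lebesgue integrals (the faces are null).
[folklore] -/
theorem setIntegral_pi_Ioc_eq_pi_Ico {E : Type*} [NormedAddCommGroup E] [NormedSpace ℝ E]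
    (f : (ι → ℝ) → E) (a b : ℝ) :
    ∫ θ in Set.pi univ (fun _ : ι => Ioc a b), f θ = ∫ θ in Set.pi univ (fun _ : ι => Ico a b), f θ := by
  refine setIntegral_congr_set ?_
  rw [volume_pi]
  exact Measure.univ_pi_Ioc_ae_eq_Icc.trans Measure.univ_pi_Ico_ae_eq_Icc.symm

end CircleHaar

end Literature.MathematicalPhysics.QuantumFieldTheory
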